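import Mathlib
import Literature.Probability.LatticeModels.SCTWardIdentity
import Summits.CriticalPhenomena.Ising3DConformalLimit.Theorems.PrecisionLaplacianMoebiusLimitOfTwoPointLawWeakDilation
import HarnessLib

/-!
# The weak special-conformal Ward identity: from `U₀`-supported tests to all tests
(stub F2 `stub_wardOfWardOnU0` of line Sketch v9 "Ward door", crux `MoebiusLimitExists`,
item stmt-CriticalPhenomena-1344)

Pure analysis on one level `F : (Fin n → ℝ³) → ℝ` of a correlation family, no probability. Let `F` be
continuous on `NonCoincident 3 n` and invariant under the diagonal translations
`x ↦ (xᵢ + v)ᵢ`, and suppose the weak special-conformal Ward identity with weight `Δ`,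
`Ward_b(F, φ) := ∫ F(x) [(2Δ−6)(Σᵢ⟪b,xᵢ⟫) φ(x) + Dφ(x)[(K_b(xᵢ))ᵢ]] dx = 0`,
`K_b(y) = ‖y‖² b − 2⟪b,y⟫ y`, holds for every direction `b` and every smooth `φ` compactly supported
in `NonCoincident 3 n ∩ U₀`, `U₀ = {x | ∀ i, xᵢ ≠ 0}`. Then it holds for every smooth `φ` compactly
supported in `NonCoincident 3 n` (`stub_wardOfWardOnU0`).

Proof ("large translation + polynomial in `t`"): pick a unit vector `a ⟂ b` (`ℝ³` has room,
`exists_unit_inner_eq_zero`) and test the hypothesis with the diagonal translate `φ_t = φ(· − t â)`,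
`â = (a, …, a)`: it is again admissible (`testFunction_translate`), and for `t ≥ R + 1`, where
`‖y‖ ≤ R` on `tsupport φ`, its support avoids the coordinate origins
(`tsupport_translate_subset_ne_zero`), so `Ward_b(F, φ_t) = 0`. Substituting `x = y + t â`
(`integral_add_right_eq_self`, `F(y + t â) = F(y)`) and expanding
`K_b(yᵢ + t a) = K_b(yᵢ) + t (2⟪a,yᵢ⟫ b − 2⟪b,yᵢ⟫ a) + t² b`, `⟪b, yᵢ + t a⟫ = ⟪b, yᵢ⟫`
(`sctField_add_smul_orth`, `ward_integrand_translate_orth`) exhibits `Ward_b(F, φ_t)` as a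
quadratic polynomial `A + t B + t² C` with `A = Ward_b(F, φ)`; a quadratic polynomial vanishing at
three points vanishes identically, so `A = 0`.

References: Di Francesco–Mathieu–Sénéchal, *Conformal Field Theory* (1997) §4.1 (4.19) (the
conformal algebra, `[K_b, P_a]`) [FrancescoMathieuSenechal1997].
-/

noncomputable section

namespace Summit.CriticalPhenomena.Ising3DConformalLimit.MoebiusLimitExistsSketchV9

open Filter Topology MeasureTheory
open Literature.Probability.LatticeModels
open EuclideanGeometry
open Summit.CriticalPhenomena.Ising3DConformalLimit.PrecisionLaplacianMoebiusLimitOfTwoPointLaw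
  (integrable_mul_of_eq_zero_off_tsupport testFunction_translate)

/-! ## Auxiliary lemmas -/

/-- In `ℝ³` every vector `b` admits a unit vector `a` orthogonal to it. [folklore] -/
theorem exists_unit_inner_eq_zero (b : EuclideanSpace ℝ (Fin 3)) :
    ∃ a : EuclideanSpace ℝ (Fin 3), ‖a‖ = 1 ∧ inner ℝ b a = 0 := by
  by_cases hb : b = 0
  · exact ⟨EuclideanSpace.single 0 1, by simp, by simp [hb]⟩
  · haveI : Fact (Module.finrank ℝ (EuclideanSpace ℝ (Fin 3)) = 2 + 1) := ⟨by simp⟩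
    have h2 : Module.finrank ℝ (ℝ ∙ b)ᗮ = 2 :=
      Submodule.finrank_orthogonal_span_singleton (n := 2) hb
    obtain ⟨c, hc⟩ :=
      (Module.finrank_pos_iff_exists_ne_zero (R := ℝ) (M := (ℝ ∙ b)ᗮ)).1 (by omega)
    have hc0 : (c : EuclideanSpace ℝ (Fin 3)) ≠ 0 := fun h => hc (Submodule.coe_eq_zero.1 h)
    have hbc : inner ℝ b c = 0 := Submodule.mem_orthogonal_singleton_iff_inner_right.1 c.2
    refine ⟨‖(c : EuclideanSpace ℝ (Fin 3))‖⁻¹ • (c : EuclideanSpace ℝ (Fin 3)), ?_, ?_⟩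
    · rw [norm_smul, norm_inv, norm_norm, inv_mul_cancel₀ (norm_ne_zero_iff.2 hc0)]
    · rw [real_inner_smul_right, hbc, mul_zero]

/-- The special conformal vector field `K_b(y) = ‖y‖² b − 2⟪b,y⟫ y` shifted along a unit direction
`a` orthogonal to `b`: `K_b(y + t a) = K_b(y) + t (2⟪a,y⟫ b − 2⟪b,y⟫ a) + t² b`. [folklore] -/
theorem sctField_add_smul_orth {a b : EuclideanSpace ℝ (Fin 3)} (ha : ‖a‖ = 1)
    (hba : inner ℝ b a = 0) (t : ℝ) (y : EuclideanSpace ℝ (Fin 3)) :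
    ‖y + t • a‖ ^ 2 • b - (2 * inner ℝ b (y + t • a)) • (y + t • a) =
      (‖y‖ ^ 2 • b - (2 * inner ℝ b y) • y) +
        t • ((2 * inner ℝ a y) • b - (2 * inner ℝ b y) • a) + t ^ 2 • b := by
  have h1 : ‖y + t • a‖ ^ 2 = ‖y‖ ^ 2 + 2 * t * inner ℝ a y + t ^ 2 := by
    rw [norm_add_sq_real, real_inner_smul_right, real_inner_comm a y, norm_smul, mul_pow, ha,
      Real.norm_eq_abs, sq_abs]
    ring
  have h2 : inner ℝ b (y + t • a) = inner ℝ b y := by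
    rw [inner_add_right, real_inner_smul_right, hba, mul_zero, add_zero]
  rw [h1, h2]
  module

/-- If `‖y‖ ≤ R` on `tsupport φ`, then for `t ≥ R + 1` and a unit vector `a` the diagonal translate
`φ(· − t â)` is supported away from the coordinate origins: on its support
`‖xᵢ‖ ≥ t − ‖xᵢ − t a‖ ≥ 1`. [folklore] -/
theorem tsupport_translate_subset_ne_zero {n : ℕ} {φ : (Fin n → EuclideanSpace ℝ (Fin 3)) → ℝ}
    {R : ℝ} (hR : ∀ y ∈ tsupport φ, ‖y‖ ≤ R) {a : EuclideanSpace ℝ (Fin 3)} (ha : ‖a‖ = 1)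
    {t : ℝ} (ht : R + 1 ≤ t) :
    tsupport (fun x => φ (x - fun _ => t • a)) ⊆ {x | ∀ i, x i ≠ 0} := by
  intro x hx i hxi
  have hx' : (x - fun _ => t • a) ∈ tsupport φ :=
    tsupport_comp_subset_preimage φ (f := fun x => x - fun _ => t • a) (by fun_prop) hx
  have h1 : ‖((x - fun _ => t • a : Fin n → EuclideanSpace ℝ (Fin 3))) i‖ ≤ R :=
    (norm_le_pi_norm _ i).trans (hR _ hx')
  have h2 : ‖((x - fun _ => t • a : Fin n → EuclideanSpace ℝ (Fin 3))) i‖ = |t| := by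
    simp [hxi, norm_smul, ha]
  rw [h2] at h1
  linarith [le_abs_self t]

/-- The `K`-Ward integrand of the translated test function `φ(· − t â)` (`a` a unit vector
orthogonal to `b`), pulled back along `x = y + t â` and using `F(y + t â) = F(y)`, is the quadratic
polynomial `A(y) + t B(y) + t² C(y)` in `t`. [folklore] -/
theorem ward_integrand_translate_orth {n : ℕ} (F : (Fin n → EuclideanSpace ℝ (Fin 3)) → ℝ)
    (Δ : ℝ) (htr : ∀ (v : EuclideanSpace ℝ (Fin 3)) (x : Fin n → EuclideanSpace ℝ (Fin 3)),
      F (fun i => x i + v) = F x)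
    (φ : (Fin n → EuclideanSpace ℝ (Fin 3)) → ℝ) {a b : EuclideanSpace ℝ (Fin 3)} (ha : ‖a‖ = 1)
    (hba : inner ℝ b a = 0) (t : ℝ) (y : Fin n → EuclideanSpace ℝ (Fin 3)) :
    F y * ((2 * Δ - 6) * (∑ i, inner ℝ b (y i)) * φ y +
          fderiv ℝ φ y (fun i => ‖y i‖ ^ 2 • b - (2 * inner ℝ b (y i)) • y i)) +
        t * (F y * fderiv ℝ φ y (fun i => (2 * inner ℝ a (y i)) • b - (2 * inner ℝ b (y i)) • a)) +
        t ^ 2 * (F y * fderiv ℝ φ y (fun _ => b)) =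
      (fun x : Fin n → EuclideanSpace ℝ (Fin 3) =>
        F x * ((2 * Δ - 6) * (∑ i, inner ℝ b (x i)) * φ (x - fun _ => t • a) +
          fderiv ℝ (fun z => φ (z - fun _ => t • a)) x
            (fun i => ‖x i‖ ^ 2 • b - (2 * inner ℝ b (x i)) • x i))) (y + fun _ => t • a) := by
  beta_reduce
  have hS : F (y + fun _ => t • a) = F y := htr (t • a) y
  have hφ : φ ((y + fun _ => t • a) - fun _ => t • a) = φ y := by rw [add_sub_cancel_right]
  have hD : fderiv ℝ (fun z => φ (z - fun _ => t • a)) (y + fun _ => t • a) = fderiv ℝ φ y := by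
    rw [fderiv_comp_sub, add_sub_cancel_right]
  have hsum : ∑ i, inner ℝ b (((y + fun _ => t • a) : Fin n → EuclideanSpace ℝ (Fin 3)) i) =
      ∑ i, inner ℝ b (y i) := by
    simp only [Pi.add_apply, inner_add_right, real_inner_smul_right, hba, mul_zero, add_zero]
  have hK : (fun i => ‖((y + fun _ => t • a) : Fin n → EuclideanSpace ℝ (Fin 3)) i‖ ^ 2 • b -
        (2 * inner ℝ b (((y + fun _ => t • a) : Fin n → EuclideanSpace ℝ (Fin 3)) i)) •
          ((y + fun _ => t • a) : Fin n → EuclideanSpace ℝ (Fin 3)) i) =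
      (fun i => ‖y i‖ ^ 2 • b - (2 * inner ℝ b (y i)) • y i) +
        t • (fun i => (2 * inner ℝ a (y i)) • b - (2 * inner ℝ b (y i)) • a) +
        t ^ 2 • fun _ => b := by
    funext i
    simp only [Pi.add_apply, Pi.smul_apply]
    exact sctField_add_smul_orth ha hba t (y i)
  rw [hS, hφ, hD, hsum, hK]
  simp only [map_add, map_smul, smul_eq_mul]
  ring

/-- Integrated form of `ward_integrand_translate_orth`: with `A = Ward_b(F, φ)`,
`B = ∫ F Dφ[(2⟪a,yᵢ⟫ b − 2⟪b,yᵢ⟫ a)ᵢ]`, `C = ∫ F Dφ[b̂]`, the `K`-Ward integral of the translate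
`φ(· − t â)` equals `∫ (A(y) + t B(y) + t² C(y)) dy` (`integral_add_right_eq_self`). [folklore] -/
theorem ward_integral_translate_orth {n : ℕ} (F : (Fin n → EuclideanSpace ℝ (Fin 3)) → ℝ)
    (Δ : ℝ) (htr : ∀ (v : EuclideanSpace ℝ (Fin 3)) (x : Fin n → EuclideanSpace ℝ (Fin 3)),
      F (fun i => x i + v) = F x)
    (φ : (Fin n → EuclideanSpace ℝ (Fin 3)) → ℝ) {a b : EuclideanSpace ℝ (Fin 3)} (ha : ‖a‖ = 1)
    (hba : inner ℝ b a = 0) (t : ℝ) :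
    ∫ y : Fin n → EuclideanSpace ℝ (Fin 3),
        (F y * ((2 * Δ - 6) * (∑ i, inner ℝ b (y i)) * φ y +
            fderiv ℝ φ y (fun i => ‖y i‖ ^ 2 • b - (2 * inner ℝ b (y i)) • y i)) +
          t * (F y * fderiv ℝ φ y
            (fun i => (2 * inner ℝ a (y i)) • b - (2 * inner ℝ b (y i)) • a)) +
          t ^ 2 * (F y * fderiv ℝ φ y (fun _ => b))) =
      ∫ x : Fin n → EuclideanSpace ℝ (Fin 3),
        F x * ((2 * Δ - 6) * (∑ i, inner ℝ b (x i)) * φ (x - fun _ => t • a) +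
          fderiv ℝ (fun z => φ (z - fun _ => t • a)) x
            (fun i => ‖x i‖ ^ 2 • b - (2 * inner ℝ b (x i)) • x i)) := by
  refine Eq.trans ?_ (integral_add_right_eq_self _ (fun _ : Fin n => t • a))
  exact integral_congr_ae
    (Eventually.of_forall fun y => ward_integrand_translate_orth F Δ htr φ ha hba t y)

/-! ## The stub -/

/-- **Stub F2 — `stub_wardOfWardOnU0`.** Extension of the weak special-conformal Ward identity
from test functions supported in `NonCoincident ∩ {∀ i, xᵢ ≠ 0}` to all test functions supported in
`NonCoincident`, for a translation-invariant `F` continuous off the diagonals: pick a unit vector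
`a ⟂ b`; the Ward functional of the translate `φ(· − t â)` equals `A + t B + t² C` with `A` the
Ward functional of `φ` (substitute `x = y + t â`, expand
`K_b(y + t a) = K_b(y) + t (2⟪a,y⟫ b − 2⟪b,y⟫ a) + t² b`), and it vanishes for all `t ≥ R + 1`
(the translated support avoids the coordinate origins), so `A = B = C = 0`.
[cite: FrancescoMathieuSenechal1997, §4.1 (4.19)] -/
theorem stub_wardOfWardOnU0 :
    ∀ (n : ℕ) (F : (Fin n → EuclideanSpace ℝ (Fin 3)) → ℝ) (Δ : ℝ),
      ContinuousOn F (NonCoincident 3 n) →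
      (∀ (v : EuclideanSpace ℝ (Fin 3)) (x : Fin n → EuclideanSpace ℝ (Fin 3)), F (fun i => x i + v) = F x) →
      (∀ (b : EuclideanSpace ℝ (Fin 3)) (φ : (Fin n → EuclideanSpace ℝ (Fin 3)) → ℝ),
        ContDiff ℝ ((⊤ : ℕ∞) : WithTop ℕ∞) φ → HasCompactSupport φ →
        tsupport φ ⊆ NonCoincident 3 n ∩ {x | ∀ i, x i ≠ 0} →
        ∫ x, F x * ((2 * Δ - 6) * (∑ i, inner ℝ b (x i)) * φ x +
          fderiv ℝ φ x (fun i => ‖x i‖ ^ 2 • b - (2 * inner ℝ b (x i)) • x i)) = 0) →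
      ∀ (b : EuclideanSpace ℝ (Fin 3)) (φ : (Fin n → EuclideanSpace ℝ (Fin 3)) → ℝ),
        ContDiff ℝ ((⊤ : ℕ∞) : WithTop ℕ∞) φ → HasCompactSupport φ → tsupport φ ⊆ NonCoincident 3 n →
        ∫ x, F x * ((2 * Δ - 6) * (∑ i, inner ℝ b (x i)) * φ x +
          fderiv ℝ φ x (fun i => ‖x i‖ ^ 2 • b - (2 * inner ℝ b (x i)) • x i)) = 0 := by
  intro n F Δ hF htr hU0 b φ hφ hφc hφV
  obtain ⟨a, ha, hba⟩ := exists_unit_inner_eq_zero b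
  have hD0 : Continuous (fderiv ℝ φ) := hφ.continuous_fderiv (by simp)
  have hV := isOpen_nonCoincident 3 n
  -- integrability of the three coefficients `A`, `B`, `C` of the polynomial identity
  have hIA : Integrable (fun y : Fin n → EuclideanSpace ℝ (Fin 3) =>
      F y * ((2 * Δ - 6) * (∑ i, inner ℝ b (y i)) * φ y +
        fderiv ℝ φ y (fun i => ‖y i‖ ^ 2 • b - (2 * inner ℝ b (y i)) • y i))) := by
    refine integrable_mul_of_eq_zero_off_tsupport hF hV hφc hφV ?_ fun y hy => ?_
    · exact (by fun_prop : Continuous fun y : Fin n → EuclideanSpace ℝ (Fin 3) =>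
          (2 * Δ - 6) * (∑ i, inner ℝ b (y i)) * φ y).add (hD0.clm_apply (by fun_prop))
    · simp [image_eq_zero_of_notMem_tsupport hy, fderiv_of_notMem_tsupport ℝ hy]
  have hIB : Integrable (fun y : Fin n → EuclideanSpace ℝ (Fin 3) =>
      F y * fderiv ℝ φ y (fun i => (2 * inner ℝ a (y i)) • b - (2 * inner ℝ b (y i)) • a)) := by
    refine integrable_mul_of_eq_zero_off_tsupport hF hV hφc hφV (hD0.clm_apply (by fun_prop))
      fun y hy => ?_
    simp [fderiv_of_notMem_tsupport ℝ hy]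
  have hIC : Integrable (fun y : Fin n → EuclideanSpace ℝ (Fin 3) =>
      F y * fderiv ℝ φ y (fun _ => b)) := by
    refine integrable_mul_of_eq_zero_off_tsupport hF hV hφc hφV (hD0.clm_apply continuous_const)
      fun y hy => ?_
    simp [fderiv_of_notMem_tsupport ℝ hy]
  -- a bound on the support of `φ`
  obtain ⟨R, hR⟩ := hφc.isCompact.isBounded.exists_norm_le
  -- the polynomial identity `A + t B + t² C = 0` for `t ≥ R + 1`
  have hpoly : ∀ t : ℝ, R + 1 ≤ t →
      (∫ y : Fin n → EuclideanSpace ℝ (Fin 3),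
          F y * ((2 * Δ - 6) * (∑ i, inner ℝ b (y i)) * φ y +
            fderiv ℝ φ y (fun i => ‖y i‖ ^ 2 • b - (2 * inner ℝ b (y i)) • y i))) +
        t * (∫ y : Fin n → EuclideanSpace ℝ (Fin 3),
          F y * fderiv ℝ φ y (fun i => (2 * inner ℝ a (y i)) • b - (2 * inner ℝ b (y i)) • a)) +
        t ^ 2 * (∫ y : Fin n → EuclideanSpace ℝ (Fin 3), F y * fderiv ℝ φ y (fun _ => b)) =
      0 := by
    intro t ht
    obtain ⟨h1, h2, h3⟩ := testFunction_translate hφ hφc hφV (t • a)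
    have h4 := tsupport_translate_subset_ne_zero hR ha ht
    have hW := hU0 b (fun x => φ (x - fun _ => t • a)) h1 h2 (Set.subset_inter h3 h4)
    have hW' := (ward_integral_translate_orth F Δ htr φ ha hba t).trans hW
    rw [integral_add (hIA.fun_add (hIB.const_mul t)) (hIC.const_mul (t ^ 2)),
      integral_add hIA (hIB.const_mul t), integral_const_mul, integral_const_mul] at hW'
    exact hW'
  -- a quadratic polynomial vanishing at `R + 1`, `R + 2`, `R + 3` has vanishing constant term
  have h0 := hpoly (R + 1) le_rfl
  have h1 := hpoly (R + 1 + 1) (by linarith)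
  have h2 := hpoly (R + 1 + 2) (by linarith)
  linear_combination ((R + 1 + 1) * (R + 1 + 2) / 2) * h0 - ((R + 1) * (R + 1 + 2)) * h1 +
    ((R + 1) * (R + 1 + 1) / 2) * h2

end Summit.CriticalPhenomena.Ising3DConformalLimit.MoebiusLimitExistsSketchV9
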